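import Summits.QuantumFields.YangMills.Theorems.IsotropyFromPowerCountingEngineFromPowerCounting
import Summits.QuantumFields.YangMills.Theorems.IsotropyFromPowerCountingTemperedCurvatureMomentsBddRenormalisationOrderZero
import HarnessLib

/-!
# `SoftKernelBoostCovariance`, Step 0 by degrees — the Yang–Mills residual of Step 0 is the regularity of `𝔖ₙ|⁰𝒮`, `n ≥ 3`

Line `Sketch` of crux `MirrorModularBoosts.SoftKernelBoostCovariance` (stmt-QuantumFields-14999;
route-QuantumFields-MirrorModularBoosts), skeleton v3.10 (lead c6), registered stub `stub_stepZeroByDegrees`.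

What the landed model-blind line CONSUMES of Step 0 is `NPointRegular S₁` (every `𝔖ₙ|⁰𝒮` of the curvature channel is integration
against a function; `cruxOfInputsK`, p136406).  This file assembles it BY DEGREES from the smallest Yang–Mills residual:

* degree `0` — E0 (`ComplexRotationBandlimit.residual_zero`, crux 11686);
* degree `1` — the degree-one layer of the item `TemperedCurvatureMoments` (T, stmt-QuantumFields-17721) holds along EVERY tied
  scheme (`DegreeOne.temperedCurvatureMoments_one`, p140708: the true density is the renormalised mean, bounded by the degree-one tie),
  read through the per-degree glue `regular_of_temperedApproximants` (the body of the landed `stub_stepZeroOfLattice`, p137944: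
  `stub_dominatedTieLimit` p108509 + `stub_regular_of_dominated` p109000 in one degree);
* degree `2` — the KERNEL TRIPLE of the crux itself (its fourth hypothesis: `S₁ 2 F = ∫ K(x₀ − x₁) F`);
* degrees `n ≥ 3` — THE RESIDUAL (the registered sorry-backed stub `stub_regularHigh` of skeleton v3.10): `𝔖ₙ|⁰𝒮` is integration
  against a function.  It is a property of the Wilson limit `S₁` ALONE (no lattice densities, no Riemann sums); each of the items T
  (`regularHigh_of_temperedCurvatureMoments`) and `CurvatureDensities` (stmt-17723, `regularHigh_of_curvatureDensities`) implies it in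
  one line, and the model-blind form is false (junk, `NPointIsotropy.Negative.not_nPointRegular_junk`; the tie is load-bearing,
  `SoftKernelBoostCovariance.Negative.not_softKernelModelBlind`).

Consequences landed here: `stub_stepZeroByDegrees` (residual ⇒ Step 0 with the kernel antecedent), and the closing recipes
`softKernelBoostCovariance_of_regularHigh` (residual → Σ in `planeRot` vocabulary → crux, by `cruxOfInputsK`) and
`softKernelBoostCovariance_of_regularHigh_of_sandwich` (residual → item `CurvatureSandwichBound` (stmt-18372) → crux).  So the crux
stmt-QuantumFields-14999 is kernel-checked modulo exactly: the item Σ and the regularity of the degrees `≥ 3`.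

References: K. Osterwalder, R. Schrader, Comm. Math. Phys. 31 (1973) §2 and 42 (1975) §2 (`⁰𝒮`, E0, temperedness of lattice
approximants); J. Glimm, A. Jaffe, Quantum Physics (1987) §9.5–9.6, §19 (lattice approximation, φ-bounds). [folklore]
-/

noncomputable section

namespace Summit.QuantumFields.YangMills.Theorems.SoftKernelBoostCovariance.Sketch

open scoped BigOperators SchwartzMap
open MeasureTheory Filter Topology
open Literature.MathematicalPhysics.QuantumLattice Literature.MathematicalPhysics.AQFT
  Literature.MathematicalPhysics.QuantumFieldTheory
open Literature.Probability.LatticeModels (box Site)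
open Summit.QuantumFields.YangMills.Theorems.NPointIsotropy.Negative (E4 NPointRegular)
open Summit.QuantumFields.YangMills.Theorems.NPointIsotropy.ComplexRotationBandlimit (residual_zero)
open Summit.QuantumFields.YangMills.Theorems.CurvatureBoostCovariance.Negative (W1 EightFrameRP PlanarCone)
open Summit.QuantumFields.YangMills.Theorems.CurvatureBoostCovariance.BoostsInheritMirrors
  (stub_dominatedTieLimit stub_regular_of_dominated)

/-! ## The per-degree glue -/

/-- **Tempered tied lattice approximants in ONE degree `n ≥ 1` ⇒ `𝔖ₙ|⁰𝒮` is a function** (the body of the landed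
`stub_stepZeroOfLattice`, p137944, read in one degree): the tempered weight `w y = C (1 + ‖y‖)^N (1 + Σ_{i ≠ j} ‖yᵢ − yⱼ‖⁻¹)^N` is
measurable, nonnegative and continuous off the coincidence locus; `stub_dominatedTieLimit` (p108509) turns the tie into the domination
`‖𝔖ₙ F‖ ≤ ∫ ‖F‖ w` on `⁰𝒮`, `stub_regular_of_dominated` (p109000) represents the dominated functional by a function. [folklore] -/
theorem regular_of_temperedApproximants
    (a : ℕ → ℝ) (L : ℕ → ℕ) (S₁ : SchwingerFamily E4) (ha_pos : ∀ k, 0 < a k)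
    (ha_tendsto : Filter.Tendsto a Filter.atTop (nhds 0))
    (haL : Filter.Tendsto (fun k => a k * L k) Filter.atTop Filter.atTop) (n : ℕ) (hn : 0 < n)
    (happrox : ∃ (D : ℕ → (Fin n → Site 4) → ℝ) (C : ℝ) (N k₀ : ℕ), 0 < C ∧
          (∀ k : ℕ, k₀ ≤ k → ∀ x : Fin n → Site 4, (∀ i, x i ∈ box 4 (L k)) → Function.Injective x →
            |D k x| ≤ C * (1 + ‖fun i => a k • siteToE (x i)‖) ^ N *
              (1 + ∑ i, ∑ j ∈ Finset.univ.erase i, ‖a k • siteToE (x i) - a k • siteToE (x j)‖⁻¹) ^ N) ∧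
          ∀ (f : Fin n → SchwartzMap E4 ℝ) (F : SchwartzMap (Fin n → E4) ℂ),
            IsTensorOf F (fun i => ofRealTest (f i)) → IsOffDiagonal F →
            Filter.Tendsto (fun k => (((a k ^ 4) ^ n *
              ∑ x ∈ Fintype.piFinset (fun _ : Fin n => box 4 (L k)),
                (∏ i, f i (a k • siteToE (x i))) * D k x : ℝ) : ℂ)) Filter.atTop (nhds (S₁ n F))) :
    ∃ W : (Fin n → E4) → ℂ, ∀ F : SchwartzMap (Fin n → E4) ℂ, IsOffDiagonal F →
      MeasureTheory.Integrable (fun y : Fin n → E4 => W y * F y) ∧ S₁ n F = ∫ y : Fin n → E4, W y * F y := by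
  obtain ⟨D, C, N, k₀, hCpos, hbound, htie⟩ := happrox
  have hcont : ContinuousOn (fun y : Fin n → E4 => C * (1 + ‖y‖) ^ N *
      (1 + ∑ i, ∑ j ∈ Finset.univ.erase i, ‖y i - y j‖⁻¹) ^ N) (coincidenceLocus n E4)ᶜ := by
    refine (continuousOn_const.mul ((continuousOn_const.add continuous_norm.continuousOn).pow N)).mul
      ((continuousOn_const.add (continuousOn_finsetSum _ fun i _ =>
        continuousOn_finsetSum _ fun j hj => ?_)).pow N)
    have hne : ∀ y ∈ (coincidenceLocus n E4)ᶜ, ‖y i - y j‖ ≠ 0 := fun y hy h =>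
      hy ⟨i, j, (Finset.ne_of_mem_erase hj).symm, sub_eq_zero.1 (norm_eq_zero.1 h)⟩
    exact ContinuousOn.inv₀ (by fun_prop) hne
  have hmeas : Measurable (fun y : Fin n → E4 => C * (1 + ‖y‖) ^ N *
      (1 + ∑ i, ∑ j ∈ Finset.univ.erase i, ‖y i - y j‖⁻¹) ^ N) := by
    fun_prop
  have hnn : ∀ y : Fin n → E4, 0 ≤ C * (1 + ‖y‖) ^ N *
      (1 + ∑ i, ∑ j ∈ Finset.univ.erase i, ‖y i - y j‖⁻¹) ^ N := fun y =>
    mul_nonneg (mul_nonneg hCpos.le (by positivity)) (by positivity)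
  exact stub_regular_of_dominated n (S₁ n) _ C N hmeas hnn (fun y _ => le_rfl)
    (stub_dominatedTieLimit n hn (S₁ n) a L D _ C N k₀ ha_pos ha_tendsto haL
      hmeas hcont hnn (fun y _ => le_rfl) hbound htie)

/-! ## Step 0 by degrees -/

/-- **Stub `stub_stepZeroByDegrees` — STEP 0 FROM THE REGULARITY OF THE DEGREES `n ≥ 3` (registered signature verbatim).**  If for
every compact simple `G`, `r`, `sch`, `S₁` with `W1 r sch S₁`, the eight frames, the cone and the kernel triple, every `𝔖ₙ|⁰𝒮` with
`n ≥ 3` is integration against a function, then every such family is `NPointRegular`: degree `0` by E0 (`residual_zero`), degree `1` by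
the degree-one layer of T along every tied scheme (`DegreeOne.temperedCurvatureMoments_one`) through `regular_of_temperedApproximants`,
degree `2` by the kernel triple (`W y = K(y₀ − y₁)`), degrees `≥ 3` by hypothesis. -/
theorem stub_stepZeroByDegrees :
    open Literature.MathematicalPhysics.QuantumLattice Literature.MathematicalPhysics.AQFT
      Literature.MathematicalPhysics.QuantumFieldTheory
      Summit.QuantumFields.YangMills.Theorems.CurvatureBoostCovariance.Negative
      Summit.QuantumFields.YangMills.Theorems.NPointIsotropy.Negative in
    (∀ (G : Type) [Group G] [TopologicalSpace G] [IsTopologicalGroup G] [CompactSpace G]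
      [MeasurableSpace G] [BorelSpace G], IsCompactSimpleLieGroup G →
      ∀ (r : LatticeRep G) (sch : SpeciesScheme (YMSpecies G)) (S₁ : SchwingerFamily E4),
        W1 r sch S₁ → EightFrameRP S₁ → PlanarCone S₁ →
        (∃ (K : E4 → ℝ) (C η : ℝ), 0 < η ∧ ContinuousOn K {x : E4 | x ≠ 0} ∧
          (∀ x : E4, x ≠ 0 → |K x| ≤ C * (1 + ‖x‖ ^ (η - 10))) ∧
          ∀ F : SchwartzMap (Fin 2 → E4) ℂ, IsOffDiagonal F →
            MeasureTheory.Integrable (fun x : Fin 2 → E4 => (K (x 0 - x 1) : ℂ) * F x) ∧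
              S₁ 2 F = ∫ x : Fin 2 → E4, (K (x 0 - x 1) : ℂ) * F x) →
        ∀ n : ℕ, 3 ≤ n → ∃ W : (Fin n → E4) → ℂ, ∀ F : SchwartzMap (Fin n → E4) ℂ, IsOffDiagonal F →
          MeasureTheory.Integrable (fun y : Fin n → E4 => W y * F y) ∧ S₁ n F = ∫ y : Fin n → E4, W y * F y) →
    ∀ (G : Type) [Group G] [TopologicalSpace G] [IsTopologicalGroup G] [CompactSpace G]
      [MeasurableSpace G] [BorelSpace G], IsCompactSimpleLieGroup G →
      ∀ (r : LatticeRep G) (sch : SpeciesScheme (YMSpecies G)) (S₁ : SchwingerFamily E4),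
        W1 r sch S₁ → EightFrameRP S₁ → PlanarCone S₁ →
        (∃ (K : E4 → ℝ) (C η : ℝ), 0 < η ∧ ContinuousOn K {x : E4 | x ≠ 0} ∧
          (∀ x : E4, x ≠ 0 → |K x| ≤ C * (1 + ‖x‖ ^ (η - 10))) ∧
          ∀ F : SchwartzMap (Fin 2 → E4) ℂ, IsOffDiagonal F →
            MeasureTheory.Integrable (fun x : Fin 2 → E4 => (K (x 0 - x 1) : ℂ) * F x) ∧
              S₁ 2 F = ∫ x : Fin 2 → E4, (K (x 0 - x 1) : ℂ) * F x) →
        NPointRegular S₁ := by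
  intro hHigh G _ _ _ _ _ _ hG r sch S₁ hW h8 hC hK n
  obtain rfl | rfl | rfl | h3 : n = 0 ∨ n = 1 ∨ n = 2 ∨ 3 ≤ n := by omega
  · exact residual_zero S₁ hW.2.1.1
  · exact regular_of_temperedApproximants sch.a sch.L S₁ sch.a_pos sch.tendsto_a sch.tendsto_L 1 one_pos
      (DegreeOne.temperedCurvatureMoments_one G hG r sch S₁ hW h8 hC)
  · obtain ⟨K, C, η, -, -, -, hKrep⟩ := hK
    exact ⟨fun y => (K (y 0 - y 1) : ℂ), hKrep⟩
  · exact hHigh G hG r sch S₁ hW h8 hC hK n h3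

/-! ## The items imply the residual -/

/-- **T implies the residual**: `TemperedCurvatureMoments` (stmt-QuantumFields-17721: tempered tied lattice densities in all degrees,
no kernel antecedent) gives the representing functions in the degrees `≥ 3` (`regular_of_temperedApproximants`). -/
theorem regularHigh_of_temperedCurvatureMoments
    (hT : Summit.QuantumFields.YangMills.Theses.IsotropyFromPowerCounting.TemperedCurvatureMoments) :
    open Literature.MathematicalPhysics.QuantumLattice Literature.MathematicalPhysics.AQFT
      Literature.MathematicalPhysics.QuantumFieldTheory
      Summit.QuantumFields.YangMills.Theorems.CurvatureBoostCovariance.Negative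
      Summit.QuantumFields.YangMills.Theorems.NPointIsotropy.Negative in
    ∀ (G : Type) [Group G] [TopologicalSpace G] [IsTopologicalGroup G] [CompactSpace G]
      [MeasurableSpace G] [BorelSpace G], IsCompactSimpleLieGroup G →
      ∀ (r : LatticeRep G) (sch : SpeciesScheme (YMSpecies G)) (S₁ : SchwingerFamily E4),
        W1 r sch S₁ → EightFrameRP S₁ → PlanarCone S₁ →
        (∃ (K : E4 → ℝ) (C η : ℝ), 0 < η ∧ ContinuousOn K {x : E4 | x ≠ 0} ∧
          (∀ x : E4, x ≠ 0 → |K x| ≤ C * (1 + ‖x‖ ^ (η - 10))) ∧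
          ∀ F : SchwartzMap (Fin 2 → E4) ℂ, IsOffDiagonal F →
            MeasureTheory.Integrable (fun x : Fin 2 → E4 => (K (x 0 - x 1) : ℂ) * F x) ∧
              S₁ 2 F = ∫ x : Fin 2 → E4, (K (x 0 - x 1) : ℂ) * F x) →
        ∀ n : ℕ, 3 ≤ n → ∃ W : (Fin n → E4) → ℂ, ∀ F : SchwartzMap (Fin n → E4) ℂ, IsOffDiagonal F →
          MeasureTheory.Integrable (fun y : Fin n → E4 => W y * F y) ∧ S₁ n F = ∫ y : Fin n → E4, W y * F y := by
  intro G _ _ _ _ _ _ hG r sch S₁ hW h8 hC _ n hn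
  exact regular_of_temperedApproximants sch.a sch.L S₁ sch.a_pos sch.tendsto_a sch.tendsto_L n (by omega)
    (hT G hG r sch S₁ hW h8 hC n (by omega))

/-- **`CurvatureDensities` implies the residual**: the item stmt-QuantumFields-17723 (`W1 → EightFrameRP → PlanarCone →
NPointRegular`, all degrees, no kernel antecedent) restricted to the degrees `≥ 3`. -/
theorem regularHigh_of_curvatureDensities
    (hD : Summit.QuantumFields.YangMills.Theses.IsotropyFromPowerCounting.CurvatureDensities) :
    open Literature.MathematicalPhysics.QuantumLattice Literature.MathematicalPhysics.AQFT
      Literature.MathematicalPhysics.QuantumFieldTheory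
      Summit.QuantumFields.YangMills.Theorems.CurvatureBoostCovariance.Negative
      Summit.QuantumFields.YangMills.Theorems.NPointIsotropy.Negative in
    ∀ (G : Type) [Group G] [TopologicalSpace G] [IsTopologicalGroup G] [CompactSpace G]
      [MeasurableSpace G] [BorelSpace G], IsCompactSimpleLieGroup G →
      ∀ (r : LatticeRep G) (sch : SpeciesScheme (YMSpecies G)) (S₁ : SchwingerFamily E4),
        W1 r sch S₁ → EightFrameRP S₁ → PlanarCone S₁ →
        (∃ (K : E4 → ℝ) (C η : ℝ), 0 < η ∧ ContinuousOn K {x : E4 | x ≠ 0} ∧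
          (∀ x : E4, x ≠ 0 → |K x| ≤ C * (1 + ‖x‖ ^ (η - 10))) ∧
          ∀ F : SchwartzMap (Fin 2 → E4) ℂ, IsOffDiagonal F →
            MeasureTheory.Integrable (fun x : Fin 2 → E4 => (K (x 0 - x 1) : ℂ) * F x) ∧
              S₁ 2 F = ∫ x : Fin 2 → E4, (K (x 0 - x 1) : ℂ) * F x) →
        ∀ n : ℕ, 3 ≤ n → ∃ W : (Fin n → E4) → ℂ, ∀ F : SchwartzMap (Fin n → E4) ℂ, IsOffDiagonal F →
          MeasureTheory.Integrable (fun y : Fin n → E4 => W y * F y) ∧ S₁ n F = ∫ y : Fin n → E4, W y * F y := by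
  intro G _ _ _ _ _ _ hG r sch S₁ hW h8 hC _ n _
  exact hD G hG r sch S₁ hW h8 hC n

/-! ## The crux modulo exactly Σ and the residual -/

/-- **THE CRUX FROM THE RESIDUAL AND Σ (in the skeleton's `planeRot` vocabulary)**: the regularity of the degrees `≥ 3` and the
two sandwich bounds (for `S₁` and its `45°` pull-back) give `MirrorModularBoosts.SoftKernelBoostCovariance` — `cruxOfInputsK` (p136406)
after `stub_stepZeroByDegrees`. -/
theorem softKernelBoostCovariance_of_regularHigh :
    open Literature.MathematicalPhysics.QuantumLattice Literature.MathematicalPhysics.AQFT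
      Literature.MathematicalPhysics.QuantumFieldTheory
      Summit.QuantumFields.YangMills.Theorems.CurvatureBoostCovariance.Negative
      Summit.QuantumFields.YangMills.Theorems.NPointIsotropy.Negative in
    (∀ (G : Type) [Group G] [TopologicalSpace G] [IsTopologicalGroup G] [CompactSpace G]
      [MeasurableSpace G] [BorelSpace G], IsCompactSimpleLieGroup G →
      ∀ (r : LatticeRep G) (sch : SpeciesScheme (YMSpecies G)) (S₁ : SchwingerFamily E4),
        W1 r sch S₁ → EightFrameRP S₁ → PlanarCone S₁ →
        (∃ (K : E4 → ℝ) (C η : ℝ), 0 < η ∧ ContinuousOn K {x : E4 | x ≠ 0} ∧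
          (∀ x : E4, x ≠ 0 → |K x| ≤ C * (1 + ‖x‖ ^ (η - 10))) ∧
          ∀ F : SchwartzMap (Fin 2 → E4) ℂ, IsOffDiagonal F →
            MeasureTheory.Integrable (fun x : Fin 2 → E4 => (K (x 0 - x 1) : ℂ) * F x) ∧
              S₁ 2 F = ∫ x : Fin 2 → E4, (K (x 0 - x 1) : ℂ) * F x) →
        ∀ n : ℕ, 3 ≤ n → ∃ W : (Fin n → E4) → ℂ, ∀ F : SchwartzMap (Fin n → E4) ℂ, IsOffDiagonal F →
          MeasureTheory.Integrable (fun y : Fin n → E4 => W y * F y) ∧ S₁ n F = ∫ y : Fin n → E4, W y * F y) →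
    (    ∀ (G : Type) [Group G] [TopologicalSpace G] [IsTopologicalGroup G] [CompactSpace G]
       [MeasurableSpace G] [BorelSpace G], IsCompactSimpleLieGroup G →
       ∀ (r : LatticeRep G) (sch : SpeciesScheme (YMSpecies G)) (S₁ : SchwingerFamily E4),
         W1 r sch S₁ → EightFrameRP S₁ → PlanarCone S₁ →
         (∃ (K : E4 → ℝ) (C η : ℝ), 0 < η ∧ ContinuousOn K {x : E4 | x ≠ 0} ∧
           (∀ x : E4, x ≠ 0 → |K x| ≤ C * (1 + ‖x‖ ^ (η - 10))) ∧
           ∀ F : SchwartzMap (Fin 2 → E4) ℂ, IsOffDiagonal F →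
             MeasureTheory.Integrable (fun x : Fin 2 → E4 => (K (x 0 - x 1) : ℂ) * F x) ∧
               S₁ 2 F = ∫ x : Fin 2 → E4, (K (x 0 - x 1) : ℂ) * F x) →
         (∀ (h : OSReconstructionNoE1 S₁.toLabelled), ∃ μ C : ℝ, μ < 4 ∧
           (∀ (u v : ℝ), 0 < u → 0 < v → u ≤ 1 → v ≤ 1 →
              ∀ (f₁ : SchwartzMap (Fin 1 → E4) ℂ) (g hh : ℝ × ℝ → ℂ) (Mg Mh Mh' : ℝ),
                (∀ x : Fin 1 → E4, f₁ x = g (x 0 0, x 0 1) * hh (x 0 2, x 0 3)) →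
                (∀ p : ℝ × ℝ, g p ≠ 0 → u ≤ p.1 ∧ p.1 ≤ 2 * u) →
                MeasureTheory.Integrable g → (∫ p, ‖g p‖) ≤ Mg →
                MeasureTheory.Integrable hh → (∫ p, ‖hh p‖) ≤ Mh → (∀ p, ‖hh p‖ ≤ Mh') →
              ∀ (n : ℕ) (W : SchwartzMap (Fin n → E4) ℂ) (hW : IsTimeOrdered W)
                (hFW : IsTimeOrdered
                  (SchwartzMap.appendTensor f₁ (translateMulti ((2 * u + v) • EuclideanSpace.single 0 1) W))),
                ‖h.fieldVec (1 + n) (fun _ => ())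
                    (SchwartzMap.appendTensor f₁ (translateMulti ((2 * u + v) • EuclideanSpace.single 0 1) W)) hFW‖
                  ≤ C * Mg * (Mh + Mh') * (u ^ (-μ) + v ^ (-μ)) * ‖h.fieldVec n (fun _ => ()) W hW‖)) ∧
         (∀ (h' : OSReconstructionNoE1 (SchwingerFamily.toLabelled
             (fun n => (S₁ n).comp (linActMulti (planeRot (0 : Fin 3) (Real.pi / 4)))))),
           ∃ μ C : ℝ, μ < 4 ∧
           (∀ (u v : ℝ), 0 < u → 0 < v → u ≤ 1 → v ≤ 1 →
              ∀ (f₁ : SchwartzMap (Fin 1 → E4) ℂ) (g hh : ℝ × ℝ → ℂ) (Mg Mh Mh' : ℝ),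
                (∀ x : Fin 1 → E4, f₁ x = g (x 0 0, x 0 1) * hh (x 0 2, x 0 3)) →
                (∀ p : ℝ × ℝ, g p ≠ 0 → u ≤ p.1 ∧ p.1 ≤ 2 * u) →
                MeasureTheory.Integrable g → (∫ p, ‖g p‖) ≤ Mg →
                MeasureTheory.Integrable hh → (∫ p, ‖hh p‖) ≤ Mh → (∀ p, ‖hh p‖ ≤ Mh') →
              ∀ (n : ℕ) (W : SchwartzMap (Fin n → E4) ℂ) (hW : IsTimeOrdered W)
                (hFW : IsTimeOrdered
                  (SchwartzMap.appendTensor f₁ (translateMulti ((2 * u + v) • EuclideanSpace.single 0 1) W))),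
                ‖h'.fieldVec (1 + n) (fun _ => ())
                    (SchwartzMap.appendTensor f₁ (translateMulti ((2 * u + v) • EuclideanSpace.single 0 1) W)) hFW‖
                  ≤ C * Mg * (Mh + Mh') * (u ^ (-μ) + v ^ (-μ)) * ‖h'.fieldVec n (fun _ => ()) W hW‖))) →
    Summit.QuantumFields.YangMills.Theses.MirrorModularBoosts.SoftKernelBoostCovariance :=
  fun hHigh hSig => cruxOfInputsK (stub_stepZeroByDegrees hHigh) hSig

/-- **THE CRUX FROM THE RESIDUAL AND THE ITEM Σ** (`CurvatureSandwichBound`, stmt-QuantumFields-18372, whose `45°` frame is named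
by coordinates; `sandwichBound_planeRot_of_curvatureSandwichBound`, p138806).  THE BY-NAME CLOSING RECIPE of skeleton v3.10: the crux
stmt-QuantumFields-14999 is kernel-checked modulo exactly Σ and the regularity of the degrees `≥ 3`. -/
theorem softKernelBoostCovariance_of_regularHigh_of_sandwich :
    open Literature.MathematicalPhysics.QuantumLattice Literature.MathematicalPhysics.AQFT
      Literature.MathematicalPhysics.QuantumFieldTheory
      Summit.QuantumFields.YangMills.Theorems.CurvatureBoostCovariance.Negative
      Summit.QuantumFields.YangMills.Theorems.NPointIsotropy.Negative in
    (∀ (G : Type) [Group G] [TopologicalSpace G] [IsTopologicalGroup G] [CompactSpace G]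
      [MeasurableSpace G] [BorelSpace G], IsCompactSimpleLieGroup G →
      ∀ (r : LatticeRep G) (sch : SpeciesScheme (YMSpecies G)) (S₁ : SchwingerFamily E4),
        W1 r sch S₁ → EightFrameRP S₁ → PlanarCone S₁ →
        (∃ (K : E4 → ℝ) (C η : ℝ), 0 < η ∧ ContinuousOn K {x : E4 | x ≠ 0} ∧
          (∀ x : E4, x ≠ 0 → |K x| ≤ C * (1 + ‖x‖ ^ (η - 10))) ∧
          ∀ F : SchwartzMap (Fin 2 → E4) ℂ, IsOffDiagonal F →
            MeasureTheory.Integrable (fun x : Fin 2 → E4 => (K (x 0 - x 1) : ℂ) * F x) ∧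
              S₁ 2 F = ∫ x : Fin 2 → E4, (K (x 0 - x 1) : ℂ) * F x) →
        ∀ n : ℕ, 3 ≤ n → ∃ W : (Fin n → E4) → ℂ, ∀ F : SchwartzMap (Fin n → E4) ℂ, IsOffDiagonal F →
          MeasureTheory.Integrable (fun y : Fin n → E4 => W y * F y) ∧ S₁ n F = ∫ y : Fin n → E4, W y * F y) →
    Summit.QuantumFields.YangMills.Theses.IsotropyFromPowerCounting.CurvatureSandwichBound →
    Summit.QuantumFields.YangMills.Theses.MirrorModularBoosts.SoftKernelBoostCovariance :=
  fun hHigh hSig => cruxOfInputsK (stub_stepZeroByDegrees hHigh) (sandwichBound_planeRot_of_curvatureSandwichBound hSig)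

end Summit.QuantumFields.YangMills.Theorems.SoftKernelBoostCovariance.Sketch

end
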